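import Summits.AtomisticToContinuum.FouriersLaw.Theorems.BondHeatUncertaintyLightConeBondHeatGibbsByParts

/-!
# `SubBallisticWindow` (stmt-AtomisticToContinuum-14070), line `Sketch`: stub `stub_gibbsMoments`

`N`-uniform even moments of single coordinates under the unnormalised Gibbs weight
`μ = e^{-H_N/T} dq dp` of the pinned anharmonic chain `pinnedChain ω₂ lam β γ` (`ω₂ > 0`,
`lam, β ≥ 0`, `T > 0`): GIVEN the Poincaré inequality for `μ` (the statement of the neighbour stub
`stub_gibbsPoincare`, taken verbatim as a hypothesis), for every `m` there is a constant `C_m` with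
`∫ q_i^{2m} dμ ≤ C_m Z` and `∫ p_i^{2m} dμ ≤ C_m Z` for ALL `N` and all sites `i` (`Z = ∫ e^{-H/T}`).

Route (`moment_step`, one induction step for a coordinate `π ∈ {q_i, p_i}`): with `G = π^{m+1}` in the
Poincaré inequality,
`∫ π^{2m+2} dμ = ∫ (G - c)² dμ + c² Z ≤ (T / min(ω₂,1)) (m+1)² ∫ π^{2m} dμ + (∫ π^{m+1} dμ)² / Z`,
`c = (∫ G dμ)/Z`; the mean term vanishes for `m = 0` (`∫ q_i e^{-H/T} = ∫ p_i e^{-H/T} = 0`: Lebesgue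
measure and `H` are invariant under `q ↦ -q` and under `p ↦ -p`) and is bounded through
`|π|^{m+1} ≤ 1 + π^{2m}` for `m ≥ 1`. Integrability of every monomial: `|q_i|, |p_i| ≤ A (1 + H)` and
`(1+H)^k e^{-H/T} ∈ L¹` (`LightConeBondHeat.pinnedChain_integrable_mul_gibbsDensity_of_le_pow`).
-/

noncomputable section

open MeasureTheory Filter

namespace Summit.AtomisticToContinuum.FouriersLaw.Theorems.SubBallisticWindow.GibbsMoments

open Literature.MathematicalPhysics.KineticTheory.HeatConduction
open Summit.AtomisticToContinuum.FouriersLaw.Theorems.LightConeBondHeat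

variable {N : ℕ}

/-! ### An elementary real inequality -/

/-- `|t^{m+1}| ≤ 1 + t^{2m}` for `m ≥ 1`. [folklore] -/
theorem abs_pow_succ_le_one_add_pow {m : ℕ} (hm : 0 < m) (t : ℝ) :
    |t ^ (m + 1)| ≤ 1 + t ^ (2 * m) := by
  rw [abs_pow]
  have h2m : |t| ^ (2 * m) = t ^ (2 * m) := by rw [pow_mul, pow_mul, sq_abs]
  have h0 : 0 ≤ t ^ (2 * m) := by rw [pow_mul]; positivity
  rcases le_or_gt |t| 1 with h | h
  · have : |t| ^ (m + 1) ≤ 1 := pow_le_one₀ (abs_nonneg t) h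
    linarith
  · have : |t| ^ (m + 1) ≤ |t| ^ (2 * m) := pow_le_pow_right₀ h.le (by omega)
    linarith

/-! ### Coordinates: gradients of their powers -/

/-- `∑_j ((∂_{q_j} q_i^{m+1})² + (∂_{p_j} q_i^{m+1})²) = (m+1)² q_i^{2m}`. [folklore] -/
theorem sum_sq_partial_position_pow (i : Fin N) (m : ℕ) (x : PhaseSpace N) :
    ∑ j : Fin N, ((partialQ j (fun y : PhaseSpace N => y.1 i ^ (m + 1)) x) ^ 2 +
        (partialP j (fun y : PhaseSpace N => y.1 i ^ (m + 1)) x) ^ 2) =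
      ((m : ℝ) + 1) ^ 2 * x.1 i ^ (2 * m) := by
  have hQ : ∀ j : Fin N, partialQ j (fun y : PhaseSpace N => y.1 i ^ (m + 1)) x =
      if j = i then ((m : ℝ) + 1) * x.1 i ^ m else 0 := by
    intro j
    unfold partialQ
    split_ifs with h
    · simp only [h, Function.update_self]
      rw [(hasDerivAt_pow (m + 1) (x.1 i)).deriv, Nat.add_sub_cancel, Nat.cast_add, Nat.cast_one]
    · simp only [Function.update_of_ne (Ne.symm h), deriv_const]
  have hPj : ∀ j : Fin N, partialP j (fun y : PhaseSpace N => y.1 i ^ (m + 1)) x = 0 := by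
    intro j
    unfold partialP
    simp only [deriv_const]
  have hj : ∀ j : Fin N, (partialQ j (fun y : PhaseSpace N => y.1 i ^ (m + 1)) x) ^ 2 +
      (partialP j (fun y : PhaseSpace N => y.1 i ^ (m + 1)) x) ^ 2 =
      if j = i then ((m : ℝ) + 1) ^ 2 * x.1 i ^ (2 * m) else 0 := by
    intro j
    rw [hQ, hPj]
    split_ifs <;> ring
  rw [Finset.sum_congr rfl fun j _ => hj j, Finset.sum_ite_eq' Finset.univ i, if_pos (Finset.mem_univ i)]

/-- `∑_j ((∂_{q_j} p_i^{m+1})² + (∂_{p_j} p_i^{m+1})²) = (m+1)² p_i^{2m}`. [folklore] -/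
theorem sum_sq_partial_momentum_pow (i : Fin N) (m : ℕ) (x : PhaseSpace N) :
    ∑ j : Fin N, ((partialQ j (fun y : PhaseSpace N => y.2 i ^ (m + 1)) x) ^ 2 +
        (partialP j (fun y : PhaseSpace N => y.2 i ^ (m + 1)) x) ^ 2) =
      ((m : ℝ) + 1) ^ 2 * x.2 i ^ (2 * m) := by
  have hPj : ∀ j : Fin N, partialP j (fun y : PhaseSpace N => y.2 i ^ (m + 1)) x =
      if j = i then ((m : ℝ) + 1) * x.2 i ^ m else 0 := by
    intro j
    unfold partialP
    split_ifs with h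
    · simp only [h, Function.update_self]
      rw [(hasDerivAt_pow (m + 1) (x.2 i)).deriv, Nat.add_sub_cancel, Nat.cast_add, Nat.cast_one]
    · simp only [Function.update_of_ne (Ne.symm h), deriv_const]
  have hQ : ∀ j : Fin N, partialQ j (fun y : PhaseSpace N => y.2 i ^ (m + 1)) x = 0 := by
    intro j
    unfold partialQ
    simp only [deriv_const]
  have hj : ∀ j : Fin N, (partialQ j (fun y : PhaseSpace N => y.2 i ^ (m + 1)) x) ^ 2 +
      (partialP j (fun y : PhaseSpace N => y.2 i ^ (m + 1)) x) ^ 2 =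
      if j = i then ((m : ℝ) + 1) ^ 2 * x.2 i ^ (2 * m) else 0 := by
    intro j
    rw [hQ, hPj]
    split_ifs <;> ring
  rw [Finset.sum_congr rfl fun j _ => hj j, Finset.sum_ite_eq' Finset.univ i, if_pos (Finset.mem_univ i)]

/-! ### The pinned chain: energy bounds and reflection symmetries of the coordinates -/

section Pinned

variable {ω₂ lam β : ℝ}

/-- `|q_i| ≤ (1 + ω₂⁻¹)(1 + H)` (`ω₂ q_i²/2 ≤ H` and `|q| ≤ ½ + q²/2`). [folklore] -/
theorem abs_position_le (hω : 0 < ω₂) (hl : 0 ≤ lam) (hβ : 0 ≤ β) (γ : ℝ) (N : ℕ)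
    (x : PhaseSpace N) (i : Fin N) :
    |x.1 i| ≤ (1 + ω₂⁻¹) * (1 + (pinnedChain ω₂ lam β γ).hamiltonian N x) := by
  have hU := pinnedChain_U_le_hamiltonian hω.le hl hβ γ N x i
  have hH0 := pinnedChain_hamiltonian_nonneg hω.le hl hβ γ N x
  have h1 := abs_le_half_add_sq_half (x.1 i)
  have hq4 : 0 ≤ lam * x.1 i ^ 4 / 4 := by positivity
  have hω' : 0 ≤ ω₂⁻¹ := inv_nonneg.mpr hω.le
  have hq2 : x.1 i ^ 2 ≤ 2 * (ω₂⁻¹ * (pinnedChain ω₂ lam β γ).hamiltonian N x) := by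
    have h2 : ω₂ * x.1 i ^ 2 ≤ 2 * (pinnedChain ω₂ lam β γ).hamiltonian N x := by linarith
    calc x.1 i ^ 2 = ω₂⁻¹ * (ω₂ * x.1 i ^ 2) := by field_simp
      _ ≤ ω₂⁻¹ * (2 * (pinnedChain ω₂ lam β γ).hamiltonian N x) := mul_le_mul_of_nonneg_left h2 hω'
      _ = 2 * (ω₂⁻¹ * (pinnedChain ω₂ lam β γ).hamiltonian N x) := by ring
  have hprod : 0 ≤ ω₂⁻¹ * (pinnedChain ω₂ lam β γ).hamiltonian N x := mul_nonneg hω' hH0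
  nlinarith

/-- `|p_i| ≤ 1 · (1 + H)` (`p_i²/2 ≤ H` and `|p| ≤ ½ + p²/2`). [folklore] -/
theorem abs_momentum_le (hω : 0 ≤ ω₂) (hl : 0 ≤ lam) (hβ : 0 ≤ β) (γ : ℝ) (N : ℕ)
    (x : PhaseSpace N) (i : Fin N) :
    |x.2 i| ≤ 1 * (1 + (pinnedChain ω₂ lam β γ).hamiltonian N x) := by
  have h := pinnedChain_harmonic_le_hamiltonian (ω₂ := ω₂) hl hβ γ N x
  have h1 : x.2 i ^ 2 / 2 ≤ ∑ k, x.2 k ^ 2 / 2 :=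
    Finset.single_le_sum (f := fun k => x.2 k ^ 2 / 2) (fun k _ => by positivity) (Finset.mem_univ i)
  have h2 : 0 ≤ ∑ k, ω₂ * x.1 k ^ 2 / 2 := Finset.sum_nonneg fun k _ => by positivity
  have h3 := abs_le_half_add_sq_half (x.2 i)
  linarith

/-- The energy of the pinned chain is even in the positions (`U`, `V` are even). [folklore] -/
theorem pinnedChain_hamiltonian_neg_position (ω₂ lam β γ : ℝ) (N : ℕ) (x : PhaseSpace N) :
    (pinnedChain ω₂ lam β γ).hamiltonian N (-x.1, x.2) = (pinnedChain ω₂ lam β γ).hamiltonian N x := by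
  simp only [OscillatorChain.hamiltonian, pinnedChain, Pi.neg_apply]
  congr 1
  · exact Finset.sum_congr rfl fun i _ => by ring
  · exact Finset.sum_congr rfl fun i _ => Finset.sum_congr rfl fun j _ => by split_ifs <;> ring

/-- `∫ q_i e^{-H/T} dq dp = 0`: the reflection `q ↦ -q` preserves Lebesgue measure and `H`. [folklore] -/
theorem integral_position_mul_gibbsDensity (ω₂ lam β γ : ℝ) (N : ℕ) (T : ℝ) (i : Fin N) :
    ∫ x, x.1 i * (pinnedChain ω₂ lam β γ).gibbsDensity N T x = 0 := by
  have hR : MeasurePreserving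
      (MeasurableEquiv.prodCongr (MeasurableEquiv.neg (Fin N → ℝ)) (MeasurableEquiv.refl (Fin N → ℝ)))
      (volume : Measure (PhaseSpace N)) volume :=
    (Measure.measurePreserving_neg (volume : Measure (Fin N → ℝ))).prod
      (MeasurePreserving.id (volume : Measure (Fin N → ℝ)))
  have h := hR.integral_comp' (fun x : PhaseSpace N => x.1 i * (pinnedChain ω₂ lam β γ).gibbsDensity N T x)
  have hRx : ∀ x : PhaseSpace N,
      (MeasurableEquiv.prodCongr (MeasurableEquiv.neg (Fin N → ℝ)) (MeasurableEquiv.refl (Fin N → ℝ))) x =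
        (-x.1, x.2) := fun x => rfl
  simp only [hRx, OscillatorChain.gibbsDensity, pinnedChain_hamiltonian_neg_position, Pi.neg_apply, neg_mul,
    integral_neg] at h
  simp only [OscillatorChain.gibbsDensity]
  linarith

/-- `∫ p_i e^{-H/T} dq dp = 0`: the momentum reversal preserves Lebesgue measure and `H`. [folklore] -/
theorem integral_momentum_mul_gibbsDensity (ω₂ lam β γ : ℝ) (N : ℕ) (T : ℝ) (i : Fin N) :
    ∫ x, x.2 i * (pinnedChain ω₂ lam β γ).gibbsDensity N T x = 0 := by
  have h := integral_comp_momentumReversal N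
    (fun x : PhaseSpace N => x.2 i * (pinnedChain ω₂ lam β γ).gibbsDensity N T x)
  simp only [OscillatorChain.gibbsDensity, OscillatorChain.hamiltonian_neg_momentum, Pi.neg_apply, neg_mul,
    integral_neg] at h
  simp only [OscillatorChain.gibbsDensity]
  linarith

/-! ### The Gibbs weight `μ = e^{-H/T} dq dp` as it is spelled in the stub -/

/-- The density of the Gibbs weight is measurable. [folklore] -/
theorem measurable_ofReal_exp_neg_hamiltonian_div (ω₂ lam β γ : ℝ) (N : ℕ) (T : ℝ) :
    Measurable fun x : PhaseSpace N =>
      ENNReal.ofReal (Real.exp (-((pinnedChain ω₂ lam β γ).hamiltonian N x) / T)) := by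
  have := pinnedChain_continuous_hamiltonian ω₂ lam β γ N
  fun_prop

variable (γ : ℝ) (N : ℕ) {T : ℝ} {μ : Measure (PhaseSpace N)} {Z : ℝ}

/-- Integrals against the Gibbs weight are `e^{-H/T}`-weighted Lebesgue integrals. [folklore] -/
theorem integral_gibbs
    (hμ : μ = volume.withDensity fun x : PhaseSpace N =>
      ENNReal.ofReal (Real.exp (-((pinnedChain ω₂ lam β γ).hamiltonian N x) / T)))
    (f : PhaseSpace N → ℝ) :
    ∫ x, f x ∂μ = ∫ x, f x * (pinnedChain ω₂ lam β γ).gibbsDensity N T x := by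
  rw [hμ, integral_withDensity_eq_integral_toReal_smul (measurable_ofReal_exp_neg_hamiltonian_div ω₂ lam β γ N T)
    (Eventually.of_forall fun _ => ENNReal.ofReal_lt_top)]
  refine integral_congr_ae (Eventually.of_forall fun x => ?_)
  simp only [ENNReal.toReal_ofReal (Real.exp_pos _).le, smul_eq_mul, OscillatorChain.gibbsDensity]
  ring

/-- Integrability against the Gibbs weight is Lebesgue integrability of `f e^{-H/T}`. [folklore] -/
theorem integrable_gibbs_iff
    (hμ : μ = volume.withDensity fun x : PhaseSpace N =>
      ENNReal.ofReal (Real.exp (-((pinnedChain ω₂ lam β γ).hamiltonian N x) / T)))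
    (f : PhaseSpace N → ℝ) :
    Integrable f μ ↔ Integrable (fun x => f x * (pinnedChain ω₂ lam β γ).gibbsDensity N T x) := by
  rw [hμ, integrable_withDensity_iff_integrable_smul' (measurable_ofReal_exp_neg_hamiltonian_div ω₂ lam β γ N T)
    (Eventually.of_forall fun _ => ENNReal.ofReal_lt_top)]
  refine integrable_congr (Eventually.of_forall fun x => ?_)
  simp only [ENNReal.toReal_ofReal (Real.exp_pos _).le, smul_eq_mul, OscillatorChain.gibbsDensity]
  ring

/-- Every power of a continuous observable `π = O(1 + H)` is integrable against the Gibbs weight. [folklore] -/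
theorem integrable_pow_gibbs (hω : 0 < ω₂) (hl : 0 ≤ lam) (hβ : 0 ≤ β) (hT : 0 < T)
    (hμ : μ = volume.withDensity fun x : PhaseSpace N =>
      ENNReal.ofReal (Real.exp (-((pinnedChain ω₂ lam β γ).hamiltonian N x) / T)))
    {π : PhaseSpace N → ℝ} (hπc : Continuous π) {A : ℝ}
    (hπH : ∀ x, |π x| ≤ A * (1 + (pinnedChain ω₂ lam β γ).hamiltonian N x)) (k : ℕ) :
    Integrable (fun x => π x ^ k) μ := by
  rw [integrable_gibbs_iff γ N hμ]
  refine pinnedChain_integrable_mul_gibbsDensity_of_le_pow hω hl hβ γ N hT k (hπc.fun_pow k) (C := A ^ k)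
    fun x => ?_
  rw [abs_pow, ← mul_pow]
  exact pow_le_pow_left₀ (abs_nonneg _) (hπH x) k

/-- **Induction step for the even moments of a coordinate.** Let `π` be a `C¹` observable with
`|π| ≤ A(1+H)`, `∫ π e^{-H/T} = 0` and `‖∇ π^{m+1}‖² = (m+1)² π^{2m}` (a single phase-space coordinate).
If the Gibbs weight `μ` satisfies the Poincaré inequality with constant `T / min(ω₂,1)` and
`∫ π^{2m} dμ ≤ C Z`, then `∫ π^{2m+2} dμ ≤ ((T / min(ω₂,1)) (m+1)² C + (1+C)²) Z`:
`∫ π^{2m+2} = ∫ (π^{m+1} - c)² dμ + c² Z` with `c = (∫ π^{m+1} dμ)/Z`, the Poincaré inequality for the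
variance, and `|∫ π^{m+1} dμ| ≤ (1 + C) Z` (`= 0` for `m = 0`; `|π|^{m+1} ≤ 1 + π^{2m}` for `m ≥ 1`).
[folklore] -/
theorem moment_step (hω : 0 < ω₂) (hl : 0 ≤ lam) (hβ : 0 ≤ β) (hT : 0 < T)
    (hμ : μ = volume.withDensity fun x : PhaseSpace N =>
      ENNReal.ofReal (Real.exp (-((pinnedChain ω₂ lam β γ).hamiltonian N x) / T)))
    (hZ : Z = ∫ x : PhaseSpace N, Real.exp (-((pinnedChain ω₂ lam β γ).hamiltonian N x) / T))
    (hP : ∀ G : PhaseSpace N → ℝ, ContDiff ℝ 1 G → MemLp G 2 μ →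
      Integrable (fun x => ∑ j : Fin N, ((partialQ j G x) ^ 2 + (partialP j G x) ^ 2)) μ →
      ∫ x, (G x - (∫ y, G y ∂μ) / Z) ^ 2 ∂μ ≤
        T / min ω₂ 1 * ∫ x, (∑ j : Fin N, ((partialQ j G x) ^ 2 + (partialP j G x) ^ 2)) ∂μ)
    {π : PhaseSpace N → ℝ} (hπd : ContDiff ℝ 1 π) {A : ℝ}
    (hπH : ∀ x, |π x| ≤ A * (1 + (pinnedChain ω₂ lam β γ).hamiltonian N x))
    (hodd : ∫ x, π x * (pinnedChain ω₂ lam β γ).gibbsDensity N T x = 0) {m : ℕ}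
    (hgrad : ∀ x, ∑ j : Fin N, ((partialQ j (fun y => π y ^ (m + 1)) x) ^ 2 +
        (partialP j (fun y => π y ^ (m + 1)) x) ^ 2) = ((m : ℝ) + 1) ^ 2 * π x ^ (2 * m))
    {C : ℝ} (hC : ∫ x, π x ^ (2 * m) ∂μ ≤ C * Z) :
    ∫ x, π x ^ (2 * (m + 1)) ∂μ ≤ (T / min ω₂ 1 * ((m : ℝ) + 1) ^ 2 * C + (1 + C) ^ 2) * Z := by
  have hK0 : 0 ≤ T / min ω₂ 1 := div_nonneg hT.le (le_min hω.le zero_le_one)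
  have hZ' : Z = ∫ x, (pinnedChain ω₂ lam β γ).gibbsDensity N T x := hZ
  have hZpos : 0 < Z := by
    rw [hZ']
    exact integral_exp_pos (pinnedChain_integrable_gibbsDensity hω hl hβ γ N hT)
  have hint : ∀ k : ℕ, Integrable (fun x => π x ^ k) μ :=
    integrable_pow_gibbs γ N hω hl hβ hT hμ hπd.continuous hπH
  have hI0 : 0 ≤ ∫ x, π x ^ (2 * m) ∂μ := integral_nonneg fun x => (even_two_mul m).pow_nonneg (π x)
  have hC0 : 0 ≤ C := by
    by_contra h
    have : C * Z < 0 := mul_neg_of_neg_of_pos (lt_of_not_ge h) hZpos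
    linarith
  -- constants
  have hconst : ∀ c : ℝ, ∫ _x, c ∂μ = c * Z := fun c => by
    rw [integral_gibbs γ N hμ, integral_const_mul, ← hZ']
  have hconst_int : ∀ c : ℝ, Integrable (fun _ : PhaseSpace N => c) μ := fun c => by
    rw [integrable_gibbs_iff γ N hμ]
    exact (pinnedChain_integrable_gibbsDensity hω hl hβ γ N hT).const_mul c
  -- the test function `G = π^{m+1}` in the Poincaré inequality
  have hG1 : ContDiff ℝ 1 (fun y => π y ^ (m + 1)) := hπd.pow (m + 1)
  have hGsq : ∀ x, (π x ^ (m + 1)) ^ 2 = π x ^ (2 * (m + 1)) := fun x => by ring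
  have hGmem : MemLp (fun y => π y ^ (m + 1)) 2 μ := by
    rw [memLp_two_iff_integrable_sq (hπd.continuous.fun_pow (m + 1)).aestronglyMeasurable]
    exact (hint (2 * (m + 1))).congr (Eventually.of_forall fun x => (hGsq x).symm)
  have hgrad_eq : (fun x => ∑ j : Fin N, ((partialQ j (fun y => π y ^ (m + 1)) x) ^ 2 +
      (partialP j (fun y => π y ^ (m + 1)) x) ^ 2)) = fun x => ((m : ℝ) + 1) ^ 2 * π x ^ (2 * m) :=
    funext hgrad
  have hgrad_int : Integrable (fun x => ∑ j : Fin N, ((partialQ j (fun y => π y ^ (m + 1)) x) ^ 2 +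
      (partialP j (fun y => π y ^ (m + 1)) x) ^ 2)) μ := by
    rw [hgrad_eq]
    exact (hint _).const_mul _
  have hPI : ∫ x, (π x ^ (m + 1) - (∫ y, π y ^ (m + 1) ∂μ) / Z) ^ 2 ∂μ ≤
      T / min ω₂ 1 * ∫ x, (∑ j : Fin N, ((partialQ j (fun y => π y ^ (m + 1)) x) ^ 2 +
        (partialP j (fun y => π y ^ (m + 1)) x) ^ 2)) ∂μ := hP _ hG1 hGmem hgrad_int
  rw [hgrad_eq, integral_const_mul] at hPI
  obtain ⟨I1, hI1⟩ : ∃ I1 : ℝ, ∫ y, π y ^ (m + 1) ∂μ = I1 := ⟨_, rfl⟩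
  rw [hI1] at hPI
  -- expansion of the variance
  have hvar : ∫ x, (π x ^ (m + 1) - I1 / Z) ^ 2 ∂μ = (∫ x, π x ^ (2 * (m + 1)) ∂μ) - I1 ^ 2 / Z := by
    have h1 : ∀ x, (π x ^ (m + 1) - I1 / Z) ^ 2 =
        (π x ^ (2 * (m + 1)) - (2 * (I1 / Z)) * π x ^ (m + 1)) + (I1 / Z) ^ 2 := fun x => by ring
    simp_rw [h1]
    rw [integral_add ((hint _).sub' ((hint _).const_mul _)) (hconst_int _),
      integral_sub (hint _) ((hint _).const_mul _), integral_const_mul, hI1, hconst]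
    have hZne : Z ≠ 0 := hZpos.ne'
    field_simp
    ring
  -- the mean term
  have hmean : I1 ^ 2 / Z ≤ (1 + C) ^ 2 * Z := by
    have habs : |I1| ≤ (1 + C) * Z := by
      rcases Nat.eq_zero_or_pos m with hm | hm
      · have hI10 : I1 = 0 := by
          rw [← hI1, integral_gibbs γ N hμ]
          simp only [hm, zero_add, pow_one]
          exact hodd
        rw [hI10, abs_zero]
        exact mul_nonneg (by linarith) hZpos.le
      · rw [← hI1]
        calc |∫ y, π y ^ (m + 1) ∂μ| ≤ ∫ y, |π y ^ (m + 1)| ∂μ := abs_integral_le_integral_abs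
          _ ≤ ∫ y, (1 + π y ^ (2 * m)) ∂μ :=
              integral_mono (hint _).abs ((hconst_int 1).fun_add (hint _))
                fun y => abs_pow_succ_le_one_add_pow hm (π y)
          _ = Z + ∫ y, π y ^ (2 * m) ∂μ := by
              rw [integral_add (hconst_int 1) (hint _), hconst, one_mul]
          _ ≤ (1 + C) * Z := by linarith
    have h2 : I1 ^ 2 ≤ ((1 + C) * Z) ^ 2 := by
      rw [← sq_abs]
      exact pow_le_pow_left₀ (abs_nonneg _) habs 2
    calc I1 ^ 2 / Z ≤ ((1 + C) * Z) ^ 2 / Z := div_le_div_of_nonneg_right h2 hZpos.le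
      _ = (1 + C) ^ 2 * Z := by
          have hZne : Z ≠ 0 := hZpos.ne'
          field_simp
  -- the Poincaré term
  have hstep : T / min ω₂ 1 * (((m : ℝ) + 1) ^ 2 * ∫ x, π x ^ (2 * m) ∂μ) ≤
      T / min ω₂ 1 * ((m : ℝ) + 1) ^ 2 * C * Z := by
    have h : ((m : ℝ) + 1) ^ 2 * ∫ x, π x ^ (2 * m) ∂μ ≤ ((m : ℝ) + 1) ^ 2 * (C * Z) :=
      mul_le_mul_of_nonneg_left hC (by positivity)
    calc T / min ω₂ 1 * (((m : ℝ) + 1) ^ 2 * ∫ x, π x ^ (2 * m) ∂μ)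
        ≤ T / min ω₂ 1 * (((m : ℝ) + 1) ^ 2 * (C * Z)) := mul_le_mul_of_nonneg_left h hK0
      _ = _ := by ring
  calc ∫ x, π x ^ (2 * (m + 1)) ∂μ
      = ∫ x, (π x ^ (m + 1) - I1 / Z) ^ 2 ∂μ + I1 ^ 2 / Z := by linarith [hvar]
    _ ≤ T / min ω₂ 1 * ((m : ℝ) + 1) ^ 2 * C * Z + (1 + C) ^ 2 * Z := add_le_add (hPI.trans hstep) hmean
    _ = _ := by ring

end Pinned

/-! ### The stub -/

/-- **Stub `stub_gibbsMoments`** (`N`-uniform even moments of single coordinates under the Gibbs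
weight; statics of the line `Sketch` of `SubBallisticWindow`). For the pinned anharmonic chain
`pinnedChain ω₂ lam β γ` with `ω₂ > 0`, `lam, β ≥ 0`, any `γ`, and `T > 0`, let
`μ = e^{-H_N/T} dq dp` and `Z = ∫ e^{-H_N/T}`; GIVEN the Poincaré inequality
`∫ (G - (∫ G dμ)/Z)² dμ ≤ (T / min(ω₂,1)) ∫ ‖∇G‖² dμ` for all `C¹` observables `G ∈ L²(μ)` with
`‖∇G‖² ∈ L¹(μ)` (every `N`), for every `m` there is `C` with `∫ q_i^{2m} dμ ≤ C Z` and
`∫ p_i^{2m} dμ ≤ C Z` for ALL `N` and all sites `i`. Proof: induction on `m` through `moment_step`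
(`G = q_i^{m+1}`, resp. `p_i^{m+1}`; the odd first moments vanish by the reflections `q ↦ -q`,
`p ↦ -p`). [folklore] -/
theorem stub_gibbsMoments :
    ∀ ω₂ lam β γ : ℝ, 0 < ω₂ → 0 ≤ lam → 0 ≤ β → ∀ T : ℝ, 0 < T →
      (∀ (N : ℕ) (G : PhaseSpace N → ℝ),
      ContDiff ℝ 1 G →
      MemLp G 2 (volume.withDensity fun x : PhaseSpace N => ENNReal.ofReal (Real.exp (-((pinnedChain ω₂ lam β γ).hamiltonian N x) / T))) →
      Integrable (fun x : PhaseSpace N => ∑ i : Fin N, ((partialQ i G x) ^ 2 + (partialP i G x) ^ 2))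
        (volume.withDensity fun x : PhaseSpace N => ENNReal.ofReal (Real.exp (-((pinnedChain ω₂ lam β γ).hamiltonian N x) / T))) →
      ∫ x, (G x - (∫ y, G y ∂(volume.withDensity fun x : PhaseSpace N => ENNReal.ofReal (Real.exp (-((pinnedChain ω₂ lam β γ).hamiltonian N x) / T)))) /
          (∫ x : PhaseSpace N, Real.exp (-((pinnedChain ω₂ lam β γ).hamiltonian N x) / T))) ^ 2
        ∂(volume.withDensity fun x : PhaseSpace N => ENNReal.ofReal (Real.exp (-((pinnedChain ω₂ lam β γ).hamiltonian N x) / T))) ≤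
        T / min ω₂ 1 * ∫ x, (∑ i : Fin N, ((partialQ i G x) ^ 2 + (partialP i G x) ^ 2))
          ∂(volume.withDensity fun x : PhaseSpace N => ENNReal.ofReal (Real.exp (-((pinnedChain ω₂ lam β γ).hamiltonian N x) / T)))) →
      ∀ m : ℕ, ∃ C : ℝ, ∀ (N : ℕ) (i : Fin N),
        ∫ x, (x.1 i) ^ (2 * m) ∂(volume.withDensity fun x : PhaseSpace N => ENNReal.ofReal (Real.exp (-((pinnedChain ω₂ lam β γ).hamiltonian N x) / T)))
            ≤ C * (∫ x : PhaseSpace N, Real.exp (-((pinnedChain ω₂ lam β γ).hamiltonian N x) / T)) ∧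
        ∫ x, (x.2 i) ^ (2 * m) ∂(volume.withDensity fun x : PhaseSpace N => ENNReal.ofReal (Real.exp (-((pinnedChain ω₂ lam β γ).hamiltonian N x) / T)))
            ≤ C * (∫ x : PhaseSpace N, Real.exp (-((pinnedChain ω₂ lam β γ).hamiltonian N x) / T)) := by
  intro ω₂ lam β γ hω hl hβ T hT hP m
  induction m with
  | zero =>
    refine ⟨1, fun N i => ?_⟩
    have h1 : ∫ _x, (1 : ℝ) ∂(volume.withDensity fun x : PhaseSpace N =>
        ENNReal.ofReal (Real.exp (-((pinnedChain ω₂ lam β γ).hamiltonian N x) / T))) =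
        ∫ x : PhaseSpace N, Real.exp (-((pinnedChain ω₂ lam β γ).hamiltonian N x) / T) := by
      rw [integral_gibbs γ N rfl]
      simp only [one_mul]
      rfl
    simp only [mul_zero, pow_zero, one_mul, h1, le_refl, and_self]
  | succ m ih =>
    obtain ⟨C, hC⟩ := ih
    refine ⟨T / min ω₂ 1 * ((m : ℝ) + 1) ^ 2 * C + (1 + C) ^ 2, fun N i => ⟨?_, ?_⟩⟩
    · exact moment_step γ N hω hl hβ hT rfl rfl (hP N) (π := fun x => x.1 i)
        ((contDiff_apply ℝ ℝ i).comp contDiff_fst) (abs_position_le hω hl hβ γ N · i)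
        (integral_position_mul_gibbsDensity ω₂ lam β γ N T i) (sum_sq_partial_position_pow i m) (hC N i).1
    · exact moment_step γ N hω hl hβ hT rfl rfl (hP N) (π := fun x => x.2 i)
        ((contDiff_apply ℝ ℝ i).comp contDiff_snd) (abs_momentum_le hω.le hl hβ γ N · i)
        (integral_momentum_mul_gibbsDensity ω₂ lam β γ N T i) (sum_sq_partial_momentum_pow i m) (hC N i).2

end Summit.AtomisticToContinuum.FouriersLaw.Theorems.SubBallisticWindow.GibbsMoments

end
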